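import Summits.BirchSwinnertonDyer.BirchSwinnertonDyer.Theorems.ManinLocalTwoThreePShiftStepHeisenberg
import HarnessLib

/-!
# The prime-generic descent engine, VIII: the Heisenberg step for EIGENFUNCTIONS — `K^ε_p(pm) = 0 ⟹ K^ε_p(p²m) = 0` (`p ∣ m`, `p ≥ 5`)
# (route `ManinLocalTwoThree`, cell bsd-f2-manin; cruxes C2 stmt-BirchSwinnertonDyer-22967 / C3 stmt-…-22968; LEAD seat p1 gen 12)

File V (`…PShiftStepHeisenberg`) runs the two-functional argument for INVARIANT `φ` (`ε = 1`).  The same argument with the corrected pair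
`μ + (εv)⁻¹·(coshift φ ε, restr φ)` works for every eigenvalue `ε ≠ 0`: the `κ`-defect of the Heisenberg pair `μ(TQ₁T⁻¹) − μ(Q₁) = −1` is
cancelled by `(εv)⁻¹·ε·v = 1`, the glued `W` is additive on `G₁`, and `P_{i/p} = R_i^p` with `R_i ∈ G₁` forces `φ(P_{1/p}) = φ(P_{2/p}) = 0`
(**`apply_P2p_eq_apply_P1p_of_dvd_eigen`**).  With file II's `descent`: **`stepEigen_of_dvd : K^ε_p(pm) = 0 ⟹ K^ε_p(p²m) = 0`** for
`p ∣ m`, `p ≥ 5`, every `ε ≠ 0` (coefficients `ℤ/p`).  Nothing about BSD, Manin's conjecture or C2/C3 is asserted here.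
[cite: DarmonDiamondTaylor1995, Lemma 4.28 (p. 135) (shape only)]
-/

set_option autoImplicit false
set_option linter.dupNamespace false

open scoped MatrixGroups

open CongruenceSubgroup Matrix.SpecialLinearGroup
  Summit.BirchSwinnertonDyer.Rank1Residual.ManinAdditive.NineShiftEqualiser

namespace Summit.BirchSwinnertonDyer.BirchSwinnertonDyer.Theorems.ManinLocalTwoThree

namespace PShiftEngine

open ThreeShiftDescent TwoShift PShiftTransfer PShiftGlue

variable {p : ℕ} [Fact p.Prime] {m : ℕ}

/-- **THE TWO-FUNCTIONAL ARGUMENT for an arbitrary eigenvalue `ε ≠ 0`**: for `p ≥ 5`, `p ∣ m`, every additive `φ : Γ₀(p²m) → ℤ/p`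
with `φ(a, pb; c, d) = ε φ(a, b; pc, d)` has `φ(P_{2/p}) = φ(P_{1/p})` (file V's `apply_P2p_eq_apply_P1p_of_dvd` is `ε = 1`; the
corrected pair is `μ + (εv)⁻¹·(coshift φ ε, restr φ)`). [new: the `p`-generic MEMO-es §37.13 (A), eigen form] -/
theorem apply_P2p_eq_apply_P1p_of_dvd_eigen (hp5 : 5 ≤ p) (hm : 0 < m) (hpm : p ∣ m) (φ : Gamma0 (p * (p * m)) → ZMod p)
    {ε : ZMod p} (hε0 : ε ≠ 0) (hadd : IsAdd φ) (hinv : IsShiftEigenP p ε φ) : φ (P2p p m) = φ (P1p p m) := by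
  classical
  have hp : p.Prime := Fact.out
  have hpL := p_dvd_level p m
  obtain ⟨m', hm'⟩ := hpm
  obtain ⟨μ, hμ⟩ := exists_heisF (p := p) hp5 hm
  by_contra hne
  set v : ZMod p := φ (P2p p m) - φ (P1p p m) with hv
  have hv0 : v ≠ 0 := sub_ne_zero.mpr hne
  set cst : ZMod p := (ε * v)⁻¹ with hcst
  have hεv0 : ε * v ≠ 0 := mul_ne_zero hε0 hv0
  -- the subgroups
  have hAn := subA1_normal (p := p) (m := m)
  set B₁ : Subgroup (Gamma0 (p * m)) := subB p m ⊓ subG1 p m with hB₁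
  have hT : Tpow (p * m) 1 ∈ B₁ := Subgroup.mem_inf.mpr ⟨Tpow_mem_subB 1, Tpow_mem_subG1 1⟩
  -- the corrected pair
  set α' : Gamma0 (p * m) → ZMod p := fun g => μ g + cst * coshift φ ε g with hα'
  set φ' : Gamma0 (p * m) → ZMod p := fun g => μ g + cst * restr φ g with hφ'
  have hcoA := coshift_add φ ε hadd (M := p * m)
  have hreB := restr_add_subB (p := p) (m := m) φ hadd
  have hαadd : ∀ x ∈ subA1 p m, ∀ y ∈ subA1 p m, α' (x * y) = α' x + α' y := by
    intro x hx y hy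
    simp only [hα']
    rw [hμ x hx.1 y hy.1, betaF_of_subA1 hx, zero_mul, add_zero, hcoA x (stabZero_of_subA1 hx) y (stabZero_of_subA1 hy)]
    ring
  have hφadd : ∀ x ∈ B₁, ∀ y ∈ B₁, φ' (x * y) = φ' x + φ' y := by
    intro x hx y hy
    obtain ⟨hxB, hxG⟩ := Subgroup.mem_inf.mp hx
    obtain ⟨hyB, hyG⟩ := Subgroup.mem_inf.mp hy
    simp only [hφ']
    rw [hμ x hxG y hyG, lamF_of_subB hm hyB, mul_zero, add_zero, hreB x hxB y hyB]
    ring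
  have hC : ∀ x ∈ subA1 p m, x ∈ B₁ → α' x = φ' x := by
    intro x hx hxB
    simp only [hα', hφ']
    rw [coshift_eq_restr_subB φ ε hinv x (stabZero_of_subA1 hx) (Subgroup.mem_inf.mp hxB).1]
  -- the κ-test: `μ(TQ₁T⁻¹) − μ(Q₁) = −1` cancels `cst·v = 1`
  have hμ1 : μ 1 = 0 := by
    have := hμ 1 (subG1 p m).one_mem 1 (subG1 p m).one_mem
    rw [mul_one] at this
    have hb : betaF (p := p) (1 : Gamma0 (p * m)) = 0 := by unfold betaF; simp [ent]
    rw [hb, zero_mul, add_zero] at this; linear_combination -this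
  have hTG := Tpow_mem_subG1 (p := p) (m := m) 1
  have hTinvG : (Tpow (p * m) 1)⁻¹ ∈ subG1 p m := (subG1 p m).inv_mem hTG
  have hQG : Q1 p m ∈ subG1 p m := (Q1_mem_subA1).1
  have hμT : μ (Tpow (p * m) 1) + μ (Tpow (p * m) 1)⁻¹ = 0 := by
    have := hμ _ hTG _ hTinvG
    rw [mul_inv_cancel, hμ1, lamF_of_subB hm ((subB p m).inv_mem (Tpow_mem_subB 1)), mul_zero, add_zero] at this
    linear_combination -this
  have hκμ : μ (Tpow (p * m) 1 * Q1 p m * (Tpow (p * m) 1)⁻¹) = μ (Q1 p m) - 1 := by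
    rw [hμ _ ((subG1 p m).mul_mem hTG hQG) _ hTinvG, hμ _ hTG _ hQG, betaF_T, lamF_Q1 hm,
      lamF_of_subB hm ((subB p m).inv_mem (Tpow_mem_subB 1)), mul_zero, add_zero]
    linear_combination hμT
  have hκ : α' (Tpow (p * m) 1 * Q1 p m * (Tpow (p * m) 1)⁻¹) = α' (Q1 p m) := by
    simp only [hα']
    rw [hκμ, coshift_conj_Q1, coshift_Q1]
    have : cst * (ε * φ (P2p p m)) - cst * (ε * φ (P1p p m)) = 1 := by
      rw [← mul_sub, ← mul_sub, ← hv, hcst, inv_mul_cancel₀ hεv0]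
    linear_combination this
  have hgen : ∀ a ∈ subA1 p m, ∃ e : ℤ, a * (Q1 p m) ^ (-e) ∈ B₁ := by
    intro a ha
    obtain ⟨e, he⟩ := exists_mul_Q1_zpow_mem_subB a ha
    exact ⟨e, Subgroup.mem_inf.mpr ⟨he, (subG1 p m).mul_mem ha.1 ((subG1 p m).zpow_mem hQG _)⟩⟩
  have hinvT := conj_invariant_of_generator hAn hαadd hφadd hC hT Q1_mem_subA1 hgen hκ
  obtain ⟨hW, -, hWB⟩ := glueOn (G₁ := subG1 p m) (fun g _ a ha => hAn.conj_mem a ha g) hαadd hφadd hC hT hTG hinvT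
    (fun g => ((g : SL(2, ℤ)) 0 0 : ℤ) * (g : SL(2, ℤ)) 0 1) mul_Tpow_neg_mem_subA1 Tpow_n_mem_subA1
  set W : Gamma0 (p * m) → ZMod p := fun g => α' (g * Tpow (p * m) 1 ^ (-(((g : SL(2, ℤ)) 0 0 : ℤ) * (g : SL(2, ℤ)) 0 1))) +
    (((g : SL(2, ℤ)) 0 0 : ℤ) * (g : SL(2, ℤ)) 0 1) • φ' (Tpow (p * m) 1) with hWdef
  have hWadd : ∀ g ∈ subG1 p m, ∀ h ∈ subG1 p m, W (g * h) = W g + W h := hW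
  -- the p-th roots
  have hm0 : (m : ℤ) = p * m' := by rw [hm']; push_cast; ring
  have key : ∀ (e f : ℤ) (hX : e * e + f * (-(p * m : ℤ)) = 0) (hpe : (p : ℤ) ∣ e)
      (hP : ((p * (p * m) : ℕ) : ℤ) ∣ (p : ℕ) * (-(p * m : ℤ))),
      φ (g0Of (1 + (p : ℕ) * e) ((p : ℕ) * f) ((p : ℕ) * (-(p * m : ℤ))) (1 - (p : ℕ) * e)
        (by linear_combination -((p : ℤ) * p) * hX) hP) = 0 := by
    intro e f hX hpe hP
    have hL : ((p * m : ℕ) : ℤ) ∣ -(p * m : ℤ) := ⟨-1, by push_cast; ring⟩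
    set R : Gamma0 (p * m) := g0Of (1 + e) f (-(p * m : ℤ)) (1 - e) (by linear_combination -hX) hL with hR
    have hRG : R ∈ subG1 p m := by
      rw [mem_subG1, hR]
      have : ent (p := p) ((g0Of (1 + e) f (-(p * m : ℤ)) (1 - e) (by linear_combination -hX) hL : Gamma0 (p * m)) : SL(2, ℤ)) 0 0 = 1 := by
        show (((1 + e : ℤ)) : ZMod p) = 1
        push_cast; rw [(ZMod.intCast_zmod_eq_zero_iff_dvd e p).mpr hpe, add_zero]
      rw [this, one_pow]
    have hRp : R ^ p = g0Of (1 + (p : ℕ) * e) ((p : ℕ) * f) ((p : ℕ) * (-(p * m : ℤ))) (1 - (p : ℕ) * e)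
        (by linear_combination -((p : ℤ) * p) * hX) (Dvd.dvd.mul_left hL p) := by
      rw [hR, unip_pow e f _ hX hL p]
    have hRpB : R ^ p ∈ B₁ := by
      refine Subgroup.mem_inf.mpr ⟨?_, (subG1 p m).pow_mem hRG p⟩
      rw [hRp]; exact g0Of_mem_subB _ _ _ _ _ _ hP
    have h1 : W (R ^ p) = 0 := by
      rw [← zpow_natCast, addOn_map_zpow hWadd hRG, natCast_zsmul, nsmul_eq_mul, ZMod.natCast_self, zero_mul]
    have h2 : W (R ^ p) = φ' (R ^ p) := hWB _ hRpB ((subG1 p m).pow_mem hRG p)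
    rw [h2] at h1
    simp only [hφ'] at h1
    rw [heis_pow_p (by omega) hμ hRG, zero_add, hRp, restr_g0Of φ _ _ _ _ _ _ hP] at h1
    rcases mul_eq_zero.mp h1 with h | h
    · exact absurd h (inv_ne_zero hεv0)
    · exact h
  have hP1 : φ (P1p p m) = 0 := by
    have h := key (-(m : ℤ)) m' (by rw [hm0]; ring) ⟨-(m' : ℤ), by rw [hm0]; ring⟩ ⟨-1, by push_cast; ring⟩
    rw [P1p]; convert h using 2; exact g0Of_congr (by ring) hm0 (by ring) (by ring) _ _ _ _
  have hP2 : φ (P2p p m) = 0 := by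
    have h := key (-(2 * m : ℤ)) (4 * m') (by rw [hm0]; ring) ⟨-(2 * m' : ℤ), by rw [hm0]; ring⟩ ⟨-1, by push_cast; ring⟩
    rw [P2p]; convert h using 2; exact g0Of_congr (by ring) (by rw [hm0]; ring) (by ring) (by ring) _ _ _ _
  exact hv0 (by rw [hv, hP1, hP2, sub_self])

/-- **`K^ε_p(pm) = 0 ⟹ K^ε_p(p²m) = 0` for `p ∣ m`, `p ≥ 5`, every `ε ≠ 0`** (coefficients `ℤ/p`). [new] -/
theorem stepEigen_of_dvd (hp5 : 5 ≤ p) (hm : 0 < m) (hpm : p ∣ m) {ε : ZMod p} (hε0 : ε ≠ 0)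
    (hbase : ShiftEigenTrivialAtP p (p * m) ε) : ShiftEigenTrivialAtP p (p * (p * m)) ε := by
  intro φ hadd hinv γ
  obtain ⟨w, hwadd, hwinv, hres⟩ := descent φ ε hm hadd hinv (apply_P2p_eq_apply_P1p_of_dvd_eigen hp5 hm hpm φ hε0 hadd hinv)
  exact TwoShift.eq_zero_of_restrictsFrom (dvd_mul_left (p * m) p) hres (hbase w hwadd hwinv) γ

end PShiftEngine

end Summit.BirchSwinnertonDyer.BirchSwinnertonDyer.Theorems.ManinLocalTwoThree
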